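import Literature.NumberTheory.Automorphic.BianchiOrdinaryClassicality
import Literature.NumberTheory.Automorphic.TwistedCentralHecke
import Literature.NumberTheory.Automorphic.HidaTowerCentralHecke
import HarnessLib

/-!
# The central character of `H^q(X_U, Ṽ_wt)`: global scalars act by `∏_τ τ(a)^{n λ_{n-1} + |λ - λ_{n-1}|}`

Topic `NumberTheory/Automorphic`; namespace `Literature.NumberTheory.Automorphic`, sub-namespaces
`GLnCohomology` / `ParallelWeight` (as `CuspidalCohomologyGL`, `BianchiOrdinaryClassicality`).
A *proofs* file (theorems only).

The scalar matrix `a · 1 ∈ GL_n` acts on the algebraic representation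
`V_λ = S_{λ−λ_{n−1}}(kⁿ) ⊗ det^{λ_{n−1}}` (`GLnCohomology.coeffRepGL`) by the scalar
`(aⁿ)^{λ_{n−1}} · a^{d}`, `d = |λ − λ_{n−1}|` (`coeffRepGL_scalar`: `a · 1` acts on `(kⁿ)^{⊗d}` by
`a^d`, `glTensorRep_scalar`), hence on the parallel-weight representation
`V_wt = ⨂_{τ : F → E} V_wt ∘ GL_n(τ)` of `GL_n(F)` (`ParallelWeight.coeffRep`) by
`ω_wt(a) = ∏_τ (τ(a)ⁿ)^{wt_{n−1}} τ(a)^{d}` (`ParallelWeight.coeffRep_scalar`).  By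
`TwistedQuotient.heckeEnd_apply_of_mem_center` (`TwistedCentralHecke`) the Hecke operator of the
principal idele `a · 1 ∈ GL_n(𝔸_F^∞)`, `a ∈ F^×`, on `H^q(X_U, Ṽ_wt(E))` is therefore
multiplication by `ω_wt(a)` (`ParallelWeight.heckeOp_globalScalar`): **the central character of
every Hecke eigensystem in `H^q(X_U, Ṽ_wt)` is a Hecke character of `𝔸_F^{∞,×}` whose restriction
to `F^×` is the algebraic character `ω_wt`** — the input "type at infinity of the central
character" of [Harder1987, §2] (for `GL₂` over imaginary quadratic `F`, `n = 2`,
`ω_wt(a) = ∏_τ τ(a)^{wt₀ + wt₁}`).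

## References

* G. Harder, *Eisenstein cohomology of arithmetic groups. The case GL₂*, Invent. Math. 89 (1987), §2
  [Harder1987].
* W. Fulton, J. Harris, *Representation Theory*, GTM 129, §15.5 [FultonHarrisGTM129].
-/

noncomputable section

open scoped NumberField TensorProduct
open IsDedekindDomain

namespace Literature.NumberTheory.Automorphic

/-! ### Scalars on `(kⁿ)^{⊗d}`, on Weyl modules and on `V_λ` -/

namespace GLnCohomology

open Literature.NumberTheory.DiophantineGeometry

section Tensor

variable (σ k : Type*) [Fintype σ] [DecidableEq σ] [CommRing k] (d : ℕ)

/-- A scalar matrix multiplies column vectors by the scalar. [folklore] -/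
theorem scalar_mulVec (a : k) (w : σ → k) : (Matrix.scalar σ a).mulVec w = a • w := by
  ext x
  simp [Matrix.scalar_apply, Matrix.mulVec_diagonal]

/-- **`a · 1` acts on `(k^σ)^{⊗d}` by `a^d`.** [cite: FultonHarrisGTM129, §15.5] -/
theorem glTensorRep_scalar (a : kˣ) (x : TensorPower k d (σ → k)) :
    glTensorRep σ k d (Matrix.GeneralLinearGroup.scalar σ a) x = ((a : k) ^ d) • x := by
  induction x using PiTensorProduct.induction_on with
  | smul_tprod r v =>
    rw [map_smul, glTensorRep_tprod, Matrix.GeneralLinearGroup.coe_scalar]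
    simp_rw [scalar_mulVec]
    rw [MultilinearMap.map_smul_univ, Finset.prod_const, Finset.card_univ, Fintype.card_fin,
      smul_comm]
  | add x y hx hy => rw [map_add, hx, hy, smul_add]

end Tensor

section Field

variable (k : Type) [Field k]

/-- `a · 1` acts on the Weyl module `S_μ(kⁿ) ⊆ (kⁿ)^{⊗d}` underlying `V_λ` by `a^d`,
`d = coeffDegree λ`. [cite: FultonHarrisGTM129, §15.5] -/
theorem weylRepCoeff_scalar (n : ℕ) (wt : Fin n → ℤ) (a : kˣ) (w : CoeffModule k n wt) :
    weylRepCoeff k n wt (Matrix.GeneralLinearGroup.scalar (Fin n) a) w =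
      ((a : k) ^ coeffDegree wt) • w := by
  change (weylRep k (Fin n) (coeffPartition wt) (Matrix.GeneralLinearGroup.scalar (Fin n) a) w :
      weylModule k (Fin n) (coeffPartition wt)) =
    (((a : k) ^ coeffDegree wt) • w : weylModule k (Fin n) (coeffPartition wt))
  refine Subtype.ext ?_
  rw [coe_weylRep_apply, glTensorRep_scalar]
  rfl

/-- `det (a · 1) = aⁿ` in `GL_n`. [folklore] -/
theorem det_scalar_fin (n : ℕ) (a : kˣ) :
    Matrix.GeneralLinearGroup.det (Matrix.GeneralLinearGroup.scalar (Fin n) a) = a ^ n := by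
  rw [Matrix.GeneralLinearGroup.det_scalar, Fintype.card_fin]

/-- **`a · 1` acts on `V_λ = S_{λ−λ_{n−1}}(kⁿ) ⊗ det^{λ_{n−1}}` by `(aⁿ)^{λ_{n−1}} · a^{d}`**,
`d = coeffDegree λ = ∑ᵢ (λᵢ − λ_{n−1})`. [cite: FultonHarrisGTM129, §15.5] -/
theorem coeffRepGL_scalar (n : ℕ) (wt : Fin n → ℤ) (a : kˣ) (w : CoeffModule k n wt) :
    coeffRepGL k n wt (Matrix.GeneralLinearGroup.scalar (Fin n) a) w =
      ((((a ^ n) ^ lowestEntry wt : kˣ) : k) * (a : k) ^ coeffDegree wt) • w := by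
  rw [coeffRepGL_apply, weylRepCoeff_scalar, smul_smul, det_scalar_fin]

end Field

end GLnCohomology

/-! ### The central character `ω_wt` of the parallel-weight representation -/

namespace ParallelWeight

variable (E : Type) [Field E] (F : Type) [Field F] (n : ℕ) (wt : Fin n → ℤ)

/-- The scalar `ω_{wt,τ}(a) = (τ(a)ⁿ)^{wt_{n−1}} · τ(a)^{d}` by which `a · 1` acts on the factor
`V_wt ∘ GL_n(τ)`. [folklore] -/
theorem coeffRepGL_map_scalar (τ : F →+* E) (a : Fˣ) (w : GLnCohomology.CoeffModule E n wt) :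
    GLnCohomology.coeffRepGL E n wt
        (Matrix.GeneralLinearGroup.map τ (Matrix.GeneralLinearGroup.scalar (Fin n) a)) w =
      (((((Units.map (τ : F →* E) a) ^ n) ^ GLnCohomology.lowestEntry wt : Eˣ) : E) *
          (τ a) ^ GLnCohomology.coeffDegree wt) • w := by
  rw [Matrix.GeneralLinearGroup.map_scalar, GLnCohomology.coeffRepGL_scalar]
  rfl

variable [NumberField F] [CharZero E]

/-- **The central character of `V_wt`**: the scalar matrix `a · 1 ∈ GL_n(F)`, `a ∈ F^×`, acts on
`V_wt(E)^{⊗ Hom(F,E)}` by `ω_wt(a) = ∏_{τ : F → E} (τ(a)ⁿ)^{wt_{n−1}} τ(a)^{d}`,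
`d = ∑ᵢ (wtᵢ − wt_{n−1})`; for `n = 2` this is `∏_τ τ(a)^{wt₀ + wt₁}`. [cite: Harder1987, §2] -/
theorem coeffRep_scalar (a : Fˣ) (v : CoeffModule E F n wt) :
    coeffRep E F n wt (Matrix.GeneralLinearGroup.scalar (Fin n) a) v =
      (∏ τ : F →+* E, ((((Units.map (τ : F →* E) a) ^ n) ^ GLnCohomology.lowestEntry wt : Eˣ) : E) *
          (τ a) ^ GLnCohomology.coeffDegree wt) • v := by
  -- the statement on the tensor product `⨂_τ V_wt(E)` underlying `CoeffModule E F n wt`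
  have key : ∀ x : ⨂[E] _τ : (F →+* E), GLnCohomology.CoeffModule E n wt,
      PiTensorProduct.map (R := E) (fun τ : F →+* E =>
        ((GLnCohomology.coeffRepGL E n wt
            (Matrix.GeneralLinearGroup.map (τ : F →+* E) (Matrix.GeneralLinearGroup.scalar (Fin n) a)) :
          GLnCohomology.CoeffModule E n wt →ₗ[E] GLnCohomology.CoeffModule E n wt))) x =
        (∏ τ : F →+* E, ((((Units.map (τ : F →* E) a) ^ n) ^ GLnCohomology.lowestEntry wt : Eˣ) : E) *
          (τ a) ^ GLnCohomology.coeffDegree wt) • x := by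
    intro x
    induction x using PiTensorProduct.induction_on with
    | smul_tprod r v =>
      rw [map_smul, PiTensorProduct.map_tprod]
      simp_rw [coeffRepGL_map_scalar]
      rw [MultilinearMap.map_smul_univ, smul_comm]
    | add x y hx hy => rw [map_add, hx, hy, smul_add]
  exact key v

/-! ### Global scalars act on `H^q(X_U, Ṽ_wt)` through `ω_wt` -/

variable (U : Subgroup (BigHeckeGLn.FiniteAdelicGL n F))

/-- **The Hecke operator of a principal scalar idele is the central character**: for `a ∈ F^×`
the operator `T_{a·1} = [U (a·1) U]` of the (central, principal) element
`a · 1 ∈ GL_n(F) ⊂ GL_n(𝔸_F^∞)` on `H^q(X_U, Ṽ_wt(E))` is multiplication by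
`ω_wt(a) = ∏_τ (τ(a)ⁿ)^{wt_{n−1}} τ(a)^{d}` (global central elements act on `H^q(GL_n(F), ·)`
through the central character of the coefficients, `TwistedQuotient.heckeEnd_apply_of_mem_center`).
Consequently `t ↦ T_{t·1}`, `t ∈ 𝔸_F^{∞,×}`, is a character of `𝔸_F^{∞,×} / (U ∩ Z)` on each
simultaneous eigenspace whose restriction to `F^×` is the algebraic character `ω_wt`.
[cite: Harder1987, §2] -/
theorem heckeOp_globalScalar (q : ℕ) (a : Fˣ) (x : cohomology E F n wt U q) :
    heckeOp E F n wt U q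
        (BigHeckeGLn.globalEmbedding n F (Matrix.GeneralLinearGroup.scalar (Fin n) a)) x =
      (∏ τ : F →+* E, ((((Units.map (τ : F →* E) a) ^ n) ^ GLnCohomology.lowestEntry wt : Eˣ) : E) *
          (τ a) ^ GLnCohomology.coeffDegree wt) • x :=
  TwistedQuotient.heckeEnd_apply_of_mem_center (V := CoeffModule E F n wt)
    (BigHeckeGLn.globalEmbedding n F) U (coeffRep E F n wt) (glScalar_mem_center a)
    (globalEmbedding_scalar_mem_center a) (coeffRep_scalar E F n wt a) q x

omit [CharZero E] in
/-- The Hecke operators of central elements of `GL_n(𝔸_F^∞)` are multiplicative on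
`H^q(X_U, Ṽ_wt(E))`: `T_{g g'} = T_g ∘ T_{g'}` for `g, g'` central. [folklore] -/
theorem heckeOp_mul_of_mem_center (q : ℕ) {g g' : BigHeckeGLn.FiniteAdelicGL n F}
    (hg : g ∈ Subgroup.center _) (hg' : g' ∈ Subgroup.center _) (x : cohomology E F n wt U q) :
    heckeOp E F n wt U q (g * g') x = heckeOp E F n wt U q g (heckeOp E F n wt U q g' x) :=
  TwistedQuotient.heckeEnd_mul_of_mem_center (V := CoeffModule E F n wt)
    (BigHeckeGLn.globalEmbedding n F) U (coeffRep E F n wt) hg hg' q x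

omit [CharZero E] in
/-- Central elements of the level act trivially on `H^q(X_U, Ṽ_wt(E))`. [folklore] -/
theorem heckeOp_eq_self_of_mem_center_of_mem (q : ℕ) {g : BigHeckeGLn.FiniteAdelicGL n F}
    (hg : g ∈ Subgroup.center _) (hgU : g ∈ U) (x : cohomology E F n wt U q) :
    heckeOp E F n wt U q g x = x :=
  TwistedQuotient.heckeEnd_eq_id_of_mem_center_of_mem (V := CoeffModule E F n wt)
    (BigHeckeGLn.globalEmbedding n F) U (coeffRep E F n wt) hg hgU q x

end ParallelWeight

end Literature.NumberTheory.Automorphic
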